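import Summits.QuantumFields.BalabanUV.T4Continuum.Support.ShellMeasureRayTermsPinned
import Summits.QuantumFields.BalabanUV.T4Continuum.Support.ShellMeasureLandauHolonomyTermsEnd

/-!
# `T4Continuum.ShellMeasureRayTermsPinnedLandau` — row S71 f2: END-II's `hE` ON THE LANDAU CHART RAYS IN THE PINNED
# INSTANCE, with a VOLUME-FREE `B_𝓔` (the junction of S71 with the LD chain and row S70)
(cell `pub-balaban`, sub-cell `t4`, spine estimate NE7c (node U5b); NE7c ROUND-2 crew, unit
`b2b-balaban-t4-ne7c-formalise-leaf-09` gen 11; owner table `t4/b2b-balaban-t4-ne7c-p1/LEAVES-NE7c-P1.md` v3.0 rows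
S70∕S71 (locality road, finding F-ne7cp1-g30-1); ADDITIVE — imports S71 f1 `ShellMeasureRayTermsPinned` (p223849) and the
LD chain's (D) `ShellMeasureLandauHolonomyTermsEnd` ONLY; [folklore]; 0 `def`, 0 `def … : Prop`, 0 sorry, 0 citations)

HONEST FRAMING.  Finite four-torus programme, rung (B)+1 only — NOT infinite volume, NOT a mass gap, NOT the Clay
problem, NOT summit progress; (B), `BetaPertHyp`, (B^μ) not consumed.  NE7c (`T4IndicatorShell.ShellWeightBound`) is
NOT PRINTED in [Balaban 1983–89] and NOT PROVED; «NE7c ⇐ the named binders» (trigger c3).  Nothing printed is asserted;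
no estimate of Bałaban's is discharged; a JUNCTION on OUR side.  HONEST DEPENDENCY (cell): continuum YM on T⁴ ⇐
BetaPertH ∧ nine spine estimates (0/9 proved); BetaPertH ⇐ (D1) ∧ (D4) ∧ CAP+tail; G-an2-4 gates asym, D1 and NE2/3/4.

THE POINT.  The LD chain's (D) `ShellMeasureLandauHolonomyTermsEnd.hE_landau_chartRay` supplies END-II's non-Wilson
ray binder `hE` for the DEFINED term `𝓔 y = Re Σ_{i∈I} 𝓔_i(Z(y))` (`Z` = the canonical Landau exponent field along the
chart ray) with `B_𝓔 = 3H̄∕(r_Φ∕S − 1)`, `H̄ ≥ Σ_i 2e_i` — VOLUME-EXTENSIVE at a live level (owner finding F-ne7cp1-g30-1: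
every localized term moves with the block).  Row S70 reads the chain in the PINNED space `𝒴 := WSup (pinW δ′ ϖ) 1 𝔄`
of S69 (the exponent field's size AND its distance-to-the-block decay in one norm); row S71 f1 (`hE_of_pinned_pairs`)
turns LOCATED per-term data + a pinned variation bound into `hE` with a volume-free constant.  THIS FILE fires (D)'s
own ray construction (`rayData_chart`, `landauCurve_along`, `landauCurve_mapsTo` BY NAME) IN THE PINNED INSTANCE and
feeds S71 f1: **`hE_landau_chartRay_pinned`** — (D) §2's point∕ray binders VERBATIM at `𝒴 := WSup (pinW δ′ ϖ) 1 𝔄`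
(`δ′ ≥ 0`, `ϖ ≥ 0`; completeness of the pinned space from that of `𝔄`, §1), per-term functionals `𝓔_i := Ef i ∘ toPiL`
with `Ef i` differentiable and `≤ e_i` on the FLAT ball `ball 0 r_E`, BLIND off a finite support `supp i` at pin-depth
`ϖP i`, the located sum `Σ_i (2e_i∕r_E)·e^{−δ′ϖP i} ≤ LK`, and the located coupling `z̄ ≤ r_E∕2`
(`z̄ = (ε₄ + B₀b) + 4C₂B₀(ε₄ + B₀b)²`, the chain's bound on `‖Z‖_pin`) ⟹ END-II's `hE` LITERALLY with
**`B_𝓔 = 3·(LK·(2z̄))∕(r_Φ∕S − 1)`** — NO `#I`, NO volume (with S71 f1 §3: `LK = (2ē∕r_E)·#B₀·m·K₁ d δ′` on the torus).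
The pinned variation binder `hpin` of S71 f1 is DISCHARGED here by the chain itself: `‖Z(σ)‖_pin ≤ z̄` on the disc
(`landauCurve_along`), hence `‖Z(σ) − Z(0)‖_pin ≤ 2z̄` (S71 f1 §4 `pin_of_norm_sub_le`).  `hB𝓔_landau_pinned` is the
companion `0 ≤ B_𝓔`.  CONSUMER: the pinned END of row S70 through the chain's (C)
`ShellMeasureLandauHolonomyWeightEnd.slotAC_realized_su2_landauChart_twoSided`, whose `hE`∕`hB𝓔` are binders with a free
`B_𝓔` — so D's non-Wilson slot becomes volume-free as its Wilson slot does by S69 §5 ∕ S70.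

DISPLAYED, NOT DISCHARGED (c2): (D)'s point∕ray binders now READ IN THE PINNED NORM ((P2) `h𝒢`, (P4) `hW`, (103) `hH₁`,
(75) `hΦ…`, (44) `hCq`∕`hCd`, (46) `hH`, scaling `hι`, the printed-type smallness — S70 f1∕f2 derive the pinned operator
bounds from DISPLAYED kernel decay via S69 (A)); the per-term pairs and localization data; the multiplicity∕budget behind
`LK`; [dict].  NOT HERE: the pinned END itself (S70 f3, leaf-01-g6), the `hfin`-side use of the extensive `Σ 2e_i`
(qualitative, harmless); NE7c NOT PROVED; spine PROVED 0∕9.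
-/

noncomputable section

open Set Metric Finset

namespace Summit.QuantumFields.BalabanUV.T4Continuum.ShellMeasureRayTermsPinnedLandau

open Literature.MathematicalPhysics.QuantumFieldTheory.Balaban1983to89
open B11Prop6Scheme (Prop4Hyp)
open Summit.QuantumFields.BalabanUV.T4Continuum.ShellMeasureMultiGridNorms (WSup)
open Summit.QuantumFields.BalabanUV.T4Continuum.ShellMeasurePinnedNorm (pinW norm_toPiL_le_of_nonneg)
open Summit.QuantumFields.BalabanUV.T4Continuum.ShellMeasureLandauExponent (currentData_zero)
open Summit.QuantumFields.BalabanUV.T4Continuum.ShellMeasureLandauHolonomy (solAt landauExp)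
open Summit.QuantumFields.BalabanUV.T4Continuum.ShellMeasureLandauHolonomyChart (cplx ofReal_smul_cplx rayData_chart)
open Summit.QuantumFields.BalabanUV.T4Continuum.ShellMeasureLandauHolonomyWeight (landauCurve_along)
open Summit.QuantumFields.BalabanUV.T4Continuum.ShellMeasureLandauHolonomyTermsEnd (landauCurve_mapsTo)
open Summit.QuantumFields.BalabanUV.T4Continuum.ShellMeasureRayWiring (rayConst_nonneg)
open Summit.QuantumFields.BalabanUV.T4Continuum.ShellMeasureRayTermsPinned (hE_of_pinned_pairs pin_of_norm_sub_le)

variable {Λ : Type*} [Fintype Λ] {𝔄 : Type*} [NormedAddCommGroup 𝔄] [NormedSpace ℂ 𝔄]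

/-! ## §1 The pinned space is complete (so the chain's fixed points live in it) -/

/-- **`WSup w α 𝔄` IS COMPLETE** for a finite index set and complete `𝔄`: S65 f2a's `toPiL` is a continuous linear
equivalence onto the flat sup-normed space, hence a uniform embedding (`ContinuousLinearEquiv.isUniformEmbedding`,
`completeSpace_congr`).  (Stated as a theorem; use `haveI`.) [folklore] -/
theorem completeSpace_wsup [CompleteSpace 𝔄] (w : Λ → ℝ) [Fact (∀ b, 0 < w b)] (α : ℕ) :
    CompleteSpace (WSup w α 𝔄) :=
  (completeSpace_congr (e := (WSup.toPiL (𝔄 := 𝔄) w α).toLinearEquiv.toEquiv)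
    (WSup.toPiL (𝔄 := 𝔄) w α).isUniformEmbedding).2 inferInstance

/-! ## §2 END-II's `hE` on the Landau chart rays, pinned instance, located terms -/

section ChartRay

variable [CompleteSpace 𝔄]
variable {𝒴' 𝒳 𝒵 ℬ : Type*} [NormedAddCommGroup 𝒴'] [NormedSpace ℂ 𝒴'] [NormedAddCommGroup 𝒳] [NormedSpace ℂ 𝒳]
  [CompleteSpace 𝒳] [NormedAddCommGroup 𝒵] [NormedSpace ℂ 𝒵] [NormedAddCommGroup ℬ] [NormedSpace ℂ ℬ]
variable {n : ℕ} {δ' : ℝ} {ϖ : Λ → ℝ}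

/-- **END-II's `hE` FOR THE DEFINED NON-WILSON TERM ON THE LANDAU CHART RAYS — PINNED INSTANCE, LOCATED TERMS,
VOLUME-FREE `B_𝓔`.**  Data: the chain's (D) §2 point∕ray binders with the exponent-field space
`𝒴 := WSup (pinW δ′ ϖ) 1 𝔄` (`0 ≤ δ′`, `0 ≤ ϖ`): chart space `Fin n → ℝ`, window `W ⊆ closedBall 0 S`, `0 < S < r_Φ`;
(P2) `h𝒢`, (P4) `hW`, (118)∕(121) `hdom`∕`hself`∕`hcontr`, (103) `hH₁`, (75) `hΦd`∕`hΦ0`∕`hΦ`, (44) `hCq`∕`hCd`, scaling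
`hι`, (46) `hH`, (54) `hq`∕`hRC` — all READ IN THE PINNED NORM; per-term functionals `Ef i : (Λ → 𝔄) → ℂ` on the FLAT
bond fields, differentiable with `‖Ef i‖ ≤ e_i` on `ball 0 r_E`, BLIND off `supp i`, supports at pin-depth `ϖP i`; the
located sum `Σ_{i∈I} (2e_i∕r_E)·e^{−δ′ϖP i} ≤ LK`; the located coupling `z̄ = (ε₄+B₀b) + 4C₂B₀(ε₄+B₀b)² ≤ r_E∕2`.
CONCLUSION — LITERALLY END-II's binder for the DEFINED term `𝓔 y := Re Σ_{i∈I} Ef i (toPiL (Z y))`,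
`Z y = landauExp C ι H (4C₂(ε₄+B₀b)²) (solAt 𝒢 0 W𝒱 ε₄ 0 (H₁ (Φ (cplx y))) + H₁ (Φ (cplx y)))`:
`∀ x ∈ W, ∀ c′, ½ ≤ c′ → c′ ≤ 1 → 𝓔 (c′ • x) ≤ 𝓔 x + (1 − c′)·(3·(LK·(2z̄))∕(r_Φ∕S − 1))`.
Proof: (D)'s `rayData_chart` + `landauCurve_along` + `landauCurve_mapsTo` (at `r_E∕2`) BY NAME in the pinned instance;
the flat curve `toPiL ∘ Z_x` lies in `ball 0 (r_E∕2)` (`‖toPiL Y‖ ≤ ‖Y‖_pin`); the pinned variation is `≤ 2z̄`; S71 f1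
`hE_of_pinned_pairs`.  Nothing of Bałaban's is asserted. [folklore] -/
theorem hE_landau_chartRay_pinned (hδ' : 0 ≤ δ') (hϖ : ∀ b, 0 ≤ ϖ b)
    {W : Set (Fin n → ℝ)} {S : ℝ} (hS : 0 < S) (hWS : W ⊆ closedBall (0 : Fin n → ℝ) S)
    {𝒢 : 𝒵 →L[ℂ] WSup (pinW δ' ϖ) 1 𝔄} {W𝒱 : WSup (pinW δ' ϖ) 1 𝔄 → 𝒵} {B₀ C₄ a₃ : ℝ}
    (h𝒢 : ∀ f, ‖𝒢 f‖ ≤ B₀ * ‖f‖) (hW : Prop4Hyp W𝒱 C₄ a₃) (hB₀ : 0 < B₀) (hC₄ : 0 ≤ C₄)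
    {b ε₄ : ℝ} (hε₄ : 0 ≤ ε₄) (hdom : 2 * (ε₄ + B₀ * b) ≤ a₃)
    (hself : B₀ * C₄ * (ε₄ + B₀ * b) ^ 2 ≤ ε₄) (hcontr : 4 * B₀ * C₄ * (ε₄ + B₀ * b) < 1)
    (H₁ : ℬ →L[ℂ] WSup (pinW δ' ϖ) 1 𝔄) (hH₁ : ∀ B, ‖H₁ B‖ ≤ B₀ * ‖B‖)
    {Φ : (Fin n → ℂ) → ℬ} {rΦ : ℝ} (hΦd : DifferentiableOn ℂ Φ (ball 0 rΦ)) (hΦ0 : Φ 0 = 0)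
    (hΦ : ∀ z ∈ ball (0 : Fin n → ℂ) rΦ, ‖Φ z‖ < b) (hSr : S < rΦ)
    {C : 𝒴' → 𝒳} {C₂ R : ℝ} (hC₂ : 0 ≤ C₂) (hCq : ∀ Z : 𝒴', ‖Z‖ < R → ‖C Z‖ ≤ C₂ * ‖Z‖ ^ 2)
    (hCd : DifferentiableOn ℂ C (ball 0 R)) (ι : WSup (pinW δ' ϖ) 1 𝔄 →L[ℂ] 𝒴') (hι : ∀ Y, ‖ι Y‖ ≤ ‖Y‖)
    (H : 𝒳 →L[ℂ] WSup (pinW δ' ϖ) 1 𝔄) (hH : ∀ X, ‖H X‖ ≤ B₀ * ‖X‖)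
    (hq : 9 * C₂ * B₀ * (ε₄ + B₀ * b) < 1) (hRC : 3 * (ε₄ + B₀ * b) ≤ R)
    -- the LOCATED per-term functionals on the flat bond fields, their pin depths, the located sum, the coupling
    {𝔱 : Type*} (I : Finset 𝔱) {Ef : 𝔱 → (Λ → 𝔄) → ℂ} {rE : ℝ} {e : 𝔱 → ℝ} (hrE : 0 < rE)
    (hEd : ∀ i ∈ I, DifferentiableOn ℂ (Ef i) (ball 0 rE))
    (hEb : ∀ i ∈ I, ∀ Z ∈ ball (0 : Λ → 𝔄) rE, ‖Ef i Z‖ ≤ e i) (he0 : ∀ i ∈ I, 0 ≤ e i)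
    (supp : 𝔱 → Finset Λ) (hblind : ∀ i ∈ I, ∀ A A' : Λ → 𝔄, (∀ b' ∈ supp i, A b' = A' b') → Ef i A = Ef i A')
    (ϖP : 𝔱 → ℝ) (hdepth : ∀ i ∈ I, ∀ b' ∈ supp i, ϖP i ≤ ϖ b')
    {LK : ℝ} (hK : ∑ i ∈ I, 2 * e i / rE * Real.exp (-(δ' * ϖP i)) ≤ LK)
    (hcoupE : (ε₄ + B₀ * b) + B₀ * (4 * C₂ * (ε₄ + B₀ * b) ^ 2) ≤ rE / 2) :
    ∀ x ∈ W, ∀ c' : ℝ, 1 / 2 ≤ c' → c' ≤ 1 →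
      (fun y => (∑ i ∈ I, Ef i (WSup.toPiL (pinW δ' ϖ) 1 (landauExp C ι H (4 * C₂ * (ε₄ + B₀ * b) ^ 2)
        (solAt 𝒢 0 W𝒱 ε₄ (0 : 𝒵) (H₁ (Φ (cplx y))) + H₁ (Φ (cplx y)))))).re) (c' • x) ≤
      (fun y => (∑ i ∈ I, Ef i (WSup.toPiL (pinW δ' ϖ) 1 (landauExp C ι H (4 * C₂ * (ε₄ + B₀ * b) ^ 2)
        (solAt 𝒢 0 W𝒱 ε₄ (0 : 𝒵) (H₁ (Φ (cplx y))) + H₁ (Φ (cplx y)))))).re) x +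
        (1 - c') * (3 * (LK * (2 * ((ε₄ + B₀ * b) + B₀ * (4 * C₂ * (ε₄ + B₀ * b) ^ 2)))) / (rΦ / S - 1)) := by
  haveI : CompleteSpace (WSup (pinW δ' ϖ) 1 𝔄) := completeSpace_wsup (pinW δ' ϖ) 1
  set zbar : ℝ := (ε₄ + B₀ * b) + B₀ * (4 * C₂ * (ε₄ + B₀ * b) ^ 2) with hzbar
  -- the curve along the chart ray over a window point (exactly (D)'s data)
  set Z : (Fin n → ℝ) → ℂ → WSup (pinW δ' ϖ) 1 𝔄 := fun x σ =>
    landauExp C ι H (4 * C₂ * (ε₄ + B₀ * b) ^ 2)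
      (solAt 𝒢 0 W𝒱 ε₄ (0 : 𝒵) (H₁ (Φ (σ • cplx x))) + H₁ (Φ (σ • cplx x))) with hZ
  have hRad1 : 1 < rΦ / S := by rw [lt_div_iff₀ hS]; linarith
  have hRad : 0 < rΦ / S := one_pos.trans hRad1
  have hΛ : ∀ Y : WSup (pinW δ' ϖ) 1 𝔄, ‖(0 : WSup (pinW δ' ϖ) 1 𝔄 →L[ℂ] WSup (pinW δ' ϖ) 1 𝔄) Y‖ ≤ 0 * ‖Y‖ :=
    fun Y => by simp
  have hself' : B₀ * 0 + 0 * (ε₄ + B₀ * b) + B₀ * C₄ * (ε₄ + B₀ * b) ^ 2 ≤ ε₄ := by simpa using hself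
  have hcontr' : 0 + 4 * B₀ * C₄ * (ε₄ + B₀ * b) < 1 := by simpa using hcontr
  have hray := fun x (hx : x ∈ W) =>
    rayData_chart H₁ hH₁ hB₀ hΦd hΦ0 hΦ hS (mem_closedBall_zero_iff.1 (hWS hx))
  -- holomorphy and the pinned bound `‖Z_x σ‖_pin ≤ z̄` on the disc
  have hcurve : ∀ x ∈ W, DifferentiableOn ℂ (Z x) (ball 0 (rΦ / S)) ∧
      ∀ σ ∈ ball (0 : ℂ) (rΦ / S), ‖Z x σ‖ ≤ zbar := fun x hx =>
    landauCurve_along h𝒢 hΛ hW hB₀.le hC₄ le_rfl hε₄ hdom hself' hcontr' hRad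
      (currentData_zero (𝒵 := 𝒵) (rΦ / S)).1 (hray x hx).1 (currentData_zero (𝒵 := 𝒵) (rΦ / S)).2.1
      (hray x hx).2.2.1 rfl (hray x hx).2.1 hC₂ hCq hCd ι hι H hH hq hRC
  -- the curve maps the disc into the PINNED ball of radius `r_E∕2`
  have hmaps : ∀ x ∈ W, MapsTo (Z x) (ball (0 : ℂ) (rΦ / S)) (ball (0 : WSup (pinW δ' ϖ) 1 𝔄) (rE / 2)) :=
    fun x hx =>
    landauCurve_mapsTo h𝒢 hΛ hW hB₀.le hC₄ le_rfl hε₄ hdom hself' hcontr' hRad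
      (currentData_zero (𝒵 := 𝒵) (rΦ / S)).1 (hray x hx).1 (currentData_zero (𝒵 := 𝒵) (rΦ / S)).2.1
      (hray x hx).2.2.1 rfl (hray x hx).2.1 hC₂ hCq hCd ι hι H hH hq hRC hcoupE
  -- the FLAT curve `toPiL ∘ Z_x`: holomorphic, into the flat ball of radius `r_E∕2`, pinned variation `≤ 2z̄`
  set e𝒴 := WSup.toPiL (𝔄 := 𝔄) (pinW δ' ϖ) 1 with he𝒴
  have hflatd : ∀ x ∈ W, DifferentiableOn ℂ (fun σ => e𝒴 (Z x σ)) (ball 0 (rΦ / S)) := fun x hx =>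
    e𝒴.toContinuousLinearMap.differentiable.comp_differentiableOn (hcurve x hx).1
  have hflatb : ∀ x ∈ W, MapsTo (fun σ => e𝒴 (Z x σ)) (ball (0 : ℂ) (rΦ / S)) (ball (0 : Λ → 𝔄) (rE / 2)) :=
    fun x hx σ hσ => by
    have h := hmaps x hx hσ
    rw [mem_ball_zero_iff] at h ⊢
    exact (norm_toPiL_le_of_nonneg hδ' hϖ (Z x σ)).trans_lt h
  have hz0 : 0 ≤ zbar := by
    -- `0 < b` (the coarse-field bound at `z = 0`), `0 ≤ ε₄`, `0 < B₀`, `0 ≤ C₂`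
    have hb : 0 ≤ b := ((norm_nonneg _).trans_lt (hΦ 0 (mem_ball_self (hS.trans hSr)))).le
    have h1 : 0 ≤ ε₄ + B₀ * b := add_nonneg hε₄ (mul_nonneg hB₀.le hb)
    have h2 : 0 ≤ B₀ * (4 * C₂ * (ε₄ + B₀ * b) ^ 2) := by positivity
    rw [hzbar]; exact add_nonneg h1 h2
  have hpin : ∀ x ∈ W, ∀ w ∈ ball (0 : ℂ) (rΦ / S), ∀ b',
      Real.exp (δ' * ϖ b') * ‖e𝒴 (Z x w) b' - e𝒴 (Z x 0) b'‖ ≤ 2 * zbar := fun x hx w hw b' => by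
    have h1 : ‖Z x w - Z x 0‖ ≤ 2 * zbar :=
      (norm_sub_le _ _).trans (by linarith [(hcurve x hx).2 w hw, (hcurve x hx).2 0 (mem_ball_self hRad)])
    have h2 := pin_of_norm_sub_le δ' ϖ (Z x w) (Z x 0) h1 b'
    simpa [he𝒴, WSup.toPiL_apply] using h2
  -- S71 f1, the sup-pair form
  have key := hE_of_pinned_pairs (E := Fin n → ℝ) (W := W) I hEd hEb he0 hrE supp hblind ϖ hδ' ϖP hdepth hRad1
    hflatd hflatb (by linarith : (0 : ℝ) ≤ 2 * zbar) hpin hK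
    (𝓔 := fun y => (∑ i ∈ I, Ef i (e𝒴 (landauExp C ι H (4 * C₂ * (ε₄ + B₀ * b) ^ 2)
      (solAt 𝒢 0 W𝒱 ε₄ (0 : 𝒵) (H₁ (Φ (cplx y))) + H₁ (Φ (cplx y)))))).re)
    (fun x _ c _ _ => by simp only [hZ, ofReal_smul_cplx])
  simpa [hzbar] using key

omit [CompleteSpace 𝔄] [CompleteSpace 𝒳] in
/-- `0 ≤ B_𝓔 = 3·(LK·(2z̄))∕(r_Φ∕S − 1)` (`0 ≤ e_i`, `0 ≤ z̄`, `S < r_Φ`). [folklore] -/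
theorem hB𝓔_landau_pinned {𝔱 : Type*} (I : Finset 𝔱) {e : 𝔱 → ℝ} {rE : ℝ} (hrE : 0 < rE) (he0 : ∀ i ∈ I, 0 ≤ e i)
    {δ' : ℝ} (ϖP : 𝔱 → ℝ) {LK zbar S rΦ : ℝ} (hS : 0 < S) (hSr : S < rΦ) (hz : 0 ≤ zbar)
    (hK : ∑ i ∈ I, 2 * e i / rE * Real.exp (-(δ' * ϖP i)) ≤ LK) :
    0 ≤ 3 * (LK * (2 * zbar)) / (rΦ / S - 1) := by
  have hRad1 : 1 < rΦ / S := by rw [lt_div_iff₀ hS]; linarith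
  refine rayConst_nonneg hRad1 (mul_nonneg ?_ (by positivity))
  exact (Finset.sum_nonneg fun i hi => mul_nonneg (by have := he0 i hi; positivity) (Real.exp_nonneg _)).trans hK

end ChartRay

end Summit.QuantumFields.BalabanUV.T4Continuum.ShellMeasureRayTermsPinnedLandau

end
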